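import Literature.Geometry.Lorentzian.TeukolskyRadialConjugation
import Literature.Geometry.Lorentzian.TeukolskyRadialSchrodingerForm
import Literature.Geometry.Lorentzian.TeukolskyHorizonNormalisedLimits
import Literature.Geometry.Lorentzian.TeukolskyInfinityNormalisedLimits
import Literature.Geometry.Lorentzian.TeukolskyRadialFluxInfinity
import Literature.Geometry.Lorentzian.KerrSurfaceGravity
import Literature.Geometry.Lorentzian.KerrTortoiseRadiusSurj

/-!
# Λ-polynomial plumbing: the TdC kernel bound from its tortoise-variable core, and the
# Wronskian bound from the kernel bound (stub `stub_polyPlumbing`)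

Crux `PhaseMixingCapture.KappaExplicitWaveDecay` (stmt-FinalStateConjecture-10654), line
`olver-dunster-uniform-reduction`, stub `stub_polyPlumbing` (skeleton v6): the Λ-POLYNOMIAL TWINS
of the landed `stub_tortoiseReduction` (`…TortoiseReduction.lean`) and `stub_wronskianOfKernel`
(`…WronskianOfKernel.lean`) — the constant `C|m|^N κ^{-N}` is replaced by `CΛ^N κ^{-N}` in
hypotheses AND conclusions; the proofs are the same (the constant is never opened).

(A) The cone Green-kernel bound for the normalised scalar radial Teukolsky pair `R_𝓗`, `R_𝓘`
(Teixeira da Costa 2020, Def. 2.3, `s = 0`),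
`√(r²+a²)‖R_𝓗 r‖ · √(r′²+a²)‖R_𝓘 r′‖ ≤ CΛ^N κ^{-N} ‖𝔚(r)‖` (`r₊ < r ≤ r′`, `r′ ≥ r₊ + θ(r₊ − r₋)`,
`m ≠ 0`, cone `|ω − mω₊| ≤ ε₀|m|`, frequency regime `P` invariant under `(ω, m) ↦ (−ω, −m)`),
FOLLOWS from the same two-point bound in Carter's tortoise variable for solutions of
`u″ + (ω² − V(ρ x))u = 0` (`V = Kerr.sepPotential`, `ρ` a tortoise radius) with the horizon data
`‖u_𝓗‖ → 1`, `‖u_𝓗′‖ → |ω − mω₊|`, `Im(ū_𝓗 u_𝓗′) ≡ −(ω − mω₊)` at `−∞`, the infinity data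
`‖u_𝓘‖ → 1`, `‖u_𝓘′‖ → |ω|`, `Im(ū_𝓘 u_𝓘′) ≡ ω` at `+∞`, and `0 < m`:
* WLOG `0 < m` (`Kerr.Costa2019.coneKernelBound_of_pos_poly`, the Λ-twin of
  `Kerr.Costa2019.coneKernelBound_of_pos`: conjugation `(ω, m, R) ↦ (−ω, −m, conj R)`, `Λ` fixed);
* the cone stays away from `ω = 0` once `ε₀ ≤ a₁/(8M²)` (`Kerr.Costa2019.abs_omega_lower_of_cone`,
  `cone_constants`); a tortoise radius exists and is a strictly increasing surjection onto
  `(r₊, ∞)` (`Kerr.exists_isTortoiseRadius`, `IsTortoiseRadius.exists_apply_eq`);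
* `u = √(ρ² + a²)·R ∘ ρ` solves Carter's equation (`Kerr.schrodingerForm`, `carter_hasDerivAt`),
  `u_𝓗 u_𝓘′ − u_𝓘 u_𝓗′ = 𝔚` (`Kerr.wronskian_schrodingerForm`); the end data are
  `Kerr.Costa2019.tendsto_norm_(deriv_)horizon/infinitySolution` along `ρ`, the fluxes
  `Im(ū u′) = Δ·Im(R̄ R′)` are `Kerr.Costa2019.radialFlux_eq_of_normalisedHorizon/Infinity`.

(B) The Wronskian lower bound `1 ≤ (CΛ^N κ^{-N})²‖𝔚(r)‖²` (`r > r₊`) from the kernel bound at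
`θ = 1`: `𝔚` is constant (`Kerr.Costa2019.radialWronskian_eq`), `√(r²+a²)‖R_𝓗 r‖ → 1` as
`r → r₊⁺` and `√(r′²+a²)‖R_𝓘 r′‖ → 1` as `r′ → ∞` (`Kerr.Costa2019.tendsto_norm_horizonSolution`,
`…infinitySolution`); let `r → r₊⁺`, then `r′ → ∞` (`one_le_of_kernelBound`), and square.

No unproved fact is used.
-/

-- the doubled `FinalStateConjecture.FinalStateConjecture` path component trips dupNamespace
set_option linter.dupNamespace false

noncomputable section

namespace Summit.FinalStateConjecture.FinalStateConjecture.Theorems.KappaExplicitWaveDecay.OlverDunsterUniformReduction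

open Literature.Geometry.Lorentzian
open MeasureTheory Filter Set Complex
open scoped Topology Manifold ENNReal Classical ComplexConjugate

/-! ### (A) Constants: the cone stays away from `ω = 0` -/

/-- **Shrinking the cone constants so that `ω ≠ 0`.** Given `a₁ < M`, `ε₀ > 0` (`M > 0`), the
constants `a₂ = a₁ ⊔ M/2 < M` and `ε₂ = ε₀ ⊓ a₂/(8M²) > 0` satisfy `a₁ ≤ a₂`, `ε₂ ≤ ε₀`, and every
`ω` with `|ω − mω₊| ≤ ε₂|m|`, `m ≠ 0`, `a₂ ≤ |a|` is non-zero: by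
`Kerr.Costa2019.abs_omega_lower_of_cone`, `|ω| ≥ (a₂/(4M²) − ε₂)|m| ≥ a₂/(8M²) > 0`. -/
private theorem cone_constants {M a₁ ε₀ : ℝ} (hM : 0 < M) (ha₁ : a₁ < M) (hε₀ : 0 < ε₀) :
    ∃ a₂ ε₂ : ℝ, a₂ < M ∧ 0 < ε₂ ∧ a₁ ≤ a₂ ∧ ε₂ ≤ ε₀ ∧
      ∀ (a ω : ℝ) (m : ℤ), a₂ ≤ |a| → m ≠ 0 →
        |ω - m * Kerr.horizonAngularVelocity M a| ≤ ε₂ * |(m : ℝ)| → ω ≠ 0 := by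
  have hpos : 0 < max a₁ (M / 2) := lt_max_of_lt_right (half_pos hM)
  refine ⟨max a₁ (M / 2), min ε₀ (max a₁ (M / 2) / (8 * M ^ 2)), max_lt ha₁ (by linarith),
    lt_min hε₀ (by positivity), le_max_left _ _, min_le_left _ _, fun a ω m ha hm hcone ↦ ?_⟩
  have h1 := Kerr.Costa2019.abs_omega_lower_of_cone hM hpos ha hcone
  have hμ : (1 : ℝ) ≤ |(m : ℝ)| := by exact_mod_cast Int.one_le_abs hm
  have h2 : min ε₀ (max a₁ (M / 2) / (8 * M ^ 2)) ≤ max a₁ (M / 2) / (8 * M ^ 2) :=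
    min_le_right _ _
  have h3 : max a₁ (M / 2) / (4 * M ^ 2) = 2 * (max a₁ (M / 2) / (8 * M ^ 2)) := by ring
  have h4 : 0 < max a₁ (M / 2) / (8 * M ^ 2) := by positivity
  have h5 : max a₁ (M / 2) / (8 * M ^ 2) ≤ |ω| := by
    calc max a₁ (M / 2) / (8 * M ^ 2) = max a₁ (M / 2) / (8 * M ^ 2) * 1 := (mul_one _).symm
      _ ≤ (max a₁ (M / 2) / (4 * M ^ 2) - min ε₀ (max a₁ (M / 2) / (8 * M ^ 2))) * |(m : ℝ)| :=
          mul_le_mul (by linarith) hμ zero_le_one (by linarith)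
      _ ≤ |ω| := h1
  exact abs_pos.mp (h4.trans_le h5)

/-! ### (A) The weight `S = √(r² + a²)`: `‖S·z‖`, `dS/dr`, and the flux `Im(ū u′) = Δ·Im(R̄ R′)` -/

/-- `‖√(r² + a²) · z‖ = √(r² + a²) · ‖z‖`. -/
private theorem norm_weight_mul (a r : ℝ) (z : ℂ) :
    ‖((Real.sqrt (r ^ 2 + a ^ 2) : ℝ) : ℂ) * z‖ = Real.sqrt (r ^ 2 + a ^ 2) * ‖z‖ := by
  rw [norm_mul, Complex.norm_of_nonneg (Real.sqrt_nonneg _)]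

-- adapted from Literature/Geometry/Lorentzian/TeukolskyHorizonNormalisedLimits.lean
/-- `d/ds (s² + a²)^{1/2} = s/(s² + a²)^{1/2}` at a point `y` with `y² + a² > 0`. -/
private theorem hasDerivAt_weight {a y : ℝ} (hy : 0 < y ^ 2 + a ^ 2) :
    HasDerivAt (fun s : ℝ ↦ Real.sqrt (s ^ 2 + a ^ 2)) (y / Real.sqrt (y ^ 2 + a ^ 2)) y := by
  have h1 : HasDerivAt (fun s : ℝ ↦ s ^ 2 + a ^ 2) (2 * y) y := by
    simpa using (hasDerivAt_pow 2 y).add_const (a ^ 2)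
  refine (h1.sqrt hy.ne').congr_deriv ?_
  rw [mul_div_mul_left _ _ (two_ne_zero' ℝ)]

/-- The algebra of the flux in the weighted variable: for real `S`, `S′`, `D` and complex `z`, `w`,
`Im( conj(S z) · D (S′ z + S w) ) = D S² · Im(z̄ w)` (`conj(z) z` is real). -/
private theorem im_conj_weight_mul (S S' D : ℝ) (z w : ℂ) :
    (conj ((S : ℂ) * z) * ((D : ℂ) * ((S' : ℂ) * z + (S : ℂ) * w))).im =
      D * S ^ 2 * (conj z * w).im := by
  simp only [Complex.mul_im, Complex.mul_re, Complex.add_re, Complex.add_im, map_mul,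
    Complex.conj_ofReal, Complex.conj_re, Complex.conj_im, Complex.ofReal_re, Complex.ofReal_im]
  ring

/-- **`Im(ū u₁) = D·(r² + a²)·Im(R̄ R′)`** for `u = √(r² + a²) R` and
`u₁ = D · d/dr[√(r² + a²) R]` at a point `r` where `R` is differentiable (`r² + a² > 0`): the
product rule `d/dr[S R] = (r/S) R + S R′` and `im_conj_weight_mul`, `S² = r² + a²`. With
`D = Δ/(r² + a²)` this is the tortoise flux `Im(ū du/dr*) = Δ·Im(R̄ dR/dr)`. -/
private theorem im_conj_u_mul_u₁ (a D : ℝ) {R : ℝ → ℂ} {r : ℝ} (hA : 0 < r ^ 2 + a ^ 2)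
    (hR : DifferentiableAt ℝ R r) :
    (conj (((Real.sqrt (r ^ 2 + a ^ 2) : ℝ) : ℂ) * R r) *
        (((D : ℝ) : ℂ) *
          deriv (fun s : ℝ ↦ ((Real.sqrt (s ^ 2 + a ^ 2) : ℝ) : ℂ) * R s) r)).im =
      D * (r ^ 2 + a ^ 2) * (conj (R r) * deriv R r).im := by
  rw [((hasDerivAt_weight hA).ofReal_comp.fun_mul hR.hasDerivAt).deriv, im_conj_weight_mul,
    Real.sq_sqrt hA.le]

/-! ### (A) Carter's equation for `u = √(ρ² + a²)·R ∘ ρ` and the end data -/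

/-- **Carter's equation along a tortoise radius** (`Kerr.schrodingerForm` with the second
derivative written as `−(ω² − V(ρ x))·u(x)`): for a classical solution `R` of the scalar radial
Teukolsky ODE (`λ = Λ − a²ω²`) and a tortoise radius `ρ`, `u = √(ρ² + a²)·R ∘ ρ` has a derivative
`u₁` on `ℝ` with `u₁′ = −(ω² − V(ρ x)) u`, and `u₁ = (Δ/(r² + a²))·d/dr[√(r² + a²) R]` at `r = ρ x`. -/
private theorem carter_hasDerivAt {M a ω Λ : ℝ} {m : ℤ} (hM : 0 < M) (ha : |a| < M) {R : ℝ → ℂ}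
    (hR : Kerr.IsRadialTeukolskySolution M a 0 ω m (Λ - a ^ 2 * ω ^ 2) R) {ρ : ℝ → ℝ}
    (hρ : Kerr.IsTortoiseRadius M a ρ) :
    ∃ u₁ : ℝ → ℂ,
      (∀ x, HasDerivAt (fun y ↦ ((Real.sqrt (ρ y ^ 2 + a ^ 2) : ℝ) : ℂ) * R (ρ y)) (u₁ x) x ∧
        HasDerivAt u₁ (-(((ω ^ 2 - Kerr.sepPotential M a ω m Λ (ρ x) : ℝ) : ℂ) *
          (((Real.sqrt (ρ x ^ 2 + a ^ 2) : ℝ) : ℂ) * R (ρ x)))) x) ∧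
      ∀ x, u₁ x = ((Kerr.delta M a (ρ x) / (ρ x ^ 2 + a ^ 2) : ℝ) : ℂ) *
          deriv (fun r : ℝ ↦ ((Real.sqrt (r ^ 2 + a ^ 2) : ℝ) : ℂ) * R r) (ρ x) := by
  obtain ⟨u₁, u₂, h⟩ := Kerr.schrodingerForm hM ha hR hρ
  refine ⟨u₁, fun x ↦ ⟨(h x).1, ?_⟩, fun x ↦ (h x).2.2.2⟩
  obtain ⟨-, h2, h3, -⟩ := h x
  rwa [eq_neg_of_add_eq_zero_left h3] at h2

/-- **Horizon data of `u_𝓗 = √(ρ² + a²)·R_𝓗 ∘ ρ`** (`R_𝓗` a classical radial solution normalised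
at `𝓗⁺`, `u₁` its tortoise derivative): `‖u_𝓗 x‖ → 1` and `‖u₁ x‖ → |ω − mω₊|` as `x → −∞`
(`Kerr.Costa2019.tendsto_norm_(deriv_)horizonSolution` along `ρ → r₊⁺`), and the flux
`Im(ū_𝓗 u₁) ≡ −(ω − mω₊)` (`Kerr.Costa2019.radialFlux_eq_of_normalisedHorizon`). -/
private theorem horizon_data {M a ω m lam : ℝ} (hM : 0 < M) (hsub : Kerr.IsSubextremal M a)
    {R : ℝ → ℂ} (hR : Kerr.IsRadialTeukolskySolution M a 0 ω m lam R)
    (hn : Kerr.IsNormalisedHorizonSolution M a 0 ω m R) {ρ : ℝ → ℝ}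
    (hρ : Kerr.IsTortoiseRadius M a ρ) {u₁ : ℝ → ℂ}
    (hu₁ : ∀ x, u₁ x = ((Kerr.delta M a (ρ x) / (ρ x ^ 2 + a ^ 2) : ℝ) : ℂ) *
      deriv (fun r : ℝ ↦ ((Real.sqrt (r ^ 2 + a ^ 2) : ℝ) : ℂ) * R r) (ρ x)) :
    Tendsto (fun x ↦ ‖((Real.sqrt (ρ x ^ 2 + a ^ 2) : ℝ) : ℂ) * R (ρ x)‖) atBot (𝓝 1) ∧
    Tendsto (fun x ↦ ‖u₁ x‖) atBot (𝓝 |ω - m * Kerr.horizonAngularVelocity M a|) ∧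
    ∀ x, (conj (((Real.sqrt (ρ x ^ 2 + a ^ 2) : ℝ) : ℂ) * R (ρ x)) * u₁ x).im =
      -(ω - m * Kerr.horizonAngularVelocity M a) := by
  have ha : |a| < M := hsub
  have hbot := hρ.tendsto_nhdsGT
  refine ⟨?_, ?_, fun x ↦ ?_⟩
  · have h : Tendsto (fun x ↦ Real.sqrt (ρ x ^ 2 + a ^ 2) * ‖R (ρ x)‖) atBot (𝓝 1) :=
      (Kerr.Costa2019.tendsto_norm_horizonSolution hn).comp hbot
    exact h.congr fun x ↦ (norm_weight_mul a (ρ x) (R (ρ x))).symm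
  · have h : Tendsto (fun x ↦ Kerr.delta M a (ρ x) / (ρ x ^ 2 + a ^ 2) *
        ‖deriv (fun s : ℝ ↦ ((Real.sqrt (s ^ 2 + a ^ 2) : ℝ) : ℂ) * R s) (ρ x)‖) atBot
        (𝓝 |ω - m * Kerr.horizonAngularVelocity M a|) :=
      (Kerr.Costa2019.tendsto_norm_deriv_horizonSolution hM ha hn).comp hbot
    refine h.congr fun x ↦ ?_
    rw [hu₁ x, norm_mul, Complex.norm_of_nonneg (hρ.deriv_pos hsub x).le]
  · obtain ⟨R', R'', hd⟩ := id hR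
    have hr := hρ.rPlus_lt x
    have hA := hρ.sq_add_sq_pos hsub x
    rw [hu₁ x, im_conj_u_mul_u₁ a _ hA (hd _ hr).1.differentiableAt, div_mul_cancel₀ _ hA.ne',
      Kerr.Costa2019.radialFlux_eq_of_normalisedHorizon ha hR hn hr]

/-- **Infinity data of `u_𝓘 = √(ρ² + a²)·R_𝓘 ∘ ρ`** (`R_𝓘` a classical radial solution normalised
at `𝓘⁺`, `ω ≠ 0`, `u₁` its tortoise derivative): `‖u_𝓘 x‖ → 1` and `‖u₁ x‖ → |ω|` as `x → +∞`
(`Kerr.Costa2019.tendsto_norm_(deriv_)infinitySolution` along `ρ → ∞`), and the flux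
`Im(ū_𝓘 u₁) ≡ ω` (`Kerr.Costa2019.radialFlux_eq_of_normalisedInfinity`). -/
private theorem infinity_data {M a ω m lam : ℝ} (hM : 0 < M) (hsub : Kerr.IsSubextremal M a)
    (hω : ω ≠ 0) {R : ℝ → ℂ} (hR : Kerr.IsRadialTeukolskySolution M a 0 ω m lam R)
    (hn : Kerr.IsNormalisedInfinitySolution M 0 ω R) {ρ : ℝ → ℝ}
    (hρ : Kerr.IsTortoiseRadius M a ρ) {u₁ : ℝ → ℂ}
    (hu₁ : ∀ x, u₁ x = ((Kerr.delta M a (ρ x) / (ρ x ^ 2 + a ^ 2) : ℝ) : ℂ) *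
      deriv (fun r : ℝ ↦ ((Real.sqrt (r ^ 2 + a ^ 2) : ℝ) : ℂ) * R r) (ρ x)) :
    Tendsto (fun x ↦ ‖((Real.sqrt (ρ x ^ 2 + a ^ 2) : ℝ) : ℂ) * R (ρ x)‖) atTop (𝓝 1) ∧
    Tendsto (fun x ↦ ‖u₁ x‖) atTop (𝓝 |ω|) ∧
    ∀ x, (conj (((Real.sqrt (ρ x ^ 2 + a ^ 2) : ℝ) : ℂ) * R (ρ x)) * u₁ x).im = ω := by
  have ha : |a| < M := hsub
  refine ⟨?_, ?_, fun x ↦ ?_⟩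
  · have h : Tendsto (fun x ↦ Real.sqrt (ρ x ^ 2 + a ^ 2) * ‖R (ρ x)‖) atTop (𝓝 1) :=
      (Kerr.Costa2019.tendsto_norm_infinitySolution (a := a) hn).comp hρ.tendsto_atTop
    exact h.congr fun x ↦ (norm_weight_mul a (ρ x) (R (ρ x))).symm
  · have h : Tendsto (fun x ↦ Kerr.delta M a (ρ x) / (ρ x ^ 2 + a ^ 2) *
        ‖deriv (fun s : ℝ ↦ ((Real.sqrt (s ^ 2 + a ^ 2) : ℝ) : ℂ) * R s) (ρ x)‖) atTop
        (𝓝 |ω|) :=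
      (Kerr.Costa2019.tendsto_norm_deriv_infinitySolution hM ha hω hR hn).comp hρ.tendsto_atTop
    refine h.congr fun x ↦ ?_
    rw [hu₁ x, norm_mul, Complex.norm_of_nonneg (hρ.deriv_pos hsub x).le]
  · obtain ⟨R', R'', hd⟩ := id hR
    have hr := hρ.rPlus_lt x
    have hA := hρ.sq_add_sq_pos hsub x
    rw [hu₁ x, im_conj_u_mul_u₁ a _ hA (hd _ hr).1.differentiableAt, div_mul_cancel₀ _ hA.ne',
      Kerr.Costa2019.radialFlux_eq_of_normalisedInfinity hM ha hω hR hn hr]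

/-! ### (B) End-point limits in a two-variable bound -/

/-- **End-point limits in a two-variable bound.** If `g → 1` as `r → x₀⁺`, `h → 1` at `+∞`, and
`g(r)·h(r′) ≤ B` whenever `x₀ < r ≤ r′` and `X ≤ r′` (`x₀ < X`), then `1 ≤ B`
(let `r → x₀⁺` at fixed `r′`, then `r′ → ∞`). -/
private theorem one_le_of_kernelBound {g h : ℝ → ℝ} {x₀ X B : ℝ} (hX : x₀ < X)
    (hg : Tendsto g (𝓝[>] x₀) (𝓝 1)) (hh : Tendsto h atTop (𝓝 1))
    (hb : ∀ r r', x₀ < r → r ≤ r' → X ≤ r' → g r * h r' ≤ B) : 1 ≤ B := by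
  -- `r → x₀⁺` at fixed `r'`
  have h3 : ∀ r', X ≤ r' → h r' ≤ B := by
    intro r' hr'
    have hlim : Tendsto (fun r ↦ g r * h r') (𝓝[>] x₀) (𝓝 (1 * h r')) := hg.mul_const (h r')
    rw [one_mul] at hlim
    refine le_of_tendsto hlim ?_
    filter_upwards [Ioo_mem_nhdsGT (hX.trans_le hr')] with r hr
    exact hb r r' hr.1 hr.2.le hr'
  -- `r' → ∞`
  refine le_of_tendsto hh ?_
  filter_upwards [eventually_ge_atTop X] with t ht
  exact h3 t ht

/-! ### The stub -/

/-- **P1 · `stub_polyPlumbing` — the Λ-polynomial twins of the landed `stub_tortoiseReduction`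
(A) and `stub_wronskianOfKernel` (B)** (line `olver-dunster-uniform-reduction`). (A): WLOG `0 < m`
(`Kerr.Costa2019.coneKernelBound_of_pos_poly`, `P` being invariant); shrink `ε₀` so that `ω ≠ 0`
in the cone (`cone_constants`); pick a tortoise radius `ρ` (`Kerr.exists_isTortoiseRadius`) and
write `r = ρ x`, `r′ = ρ x′`, `x ≤ x′` (`IsTortoiseRadius.exists_apply_eq`, monotonicity); put
`u := √(ρ² + a²)·R ∘ ρ` with the derivative witness of `Kerr.schrodingerForm`
(`carter_hasDerivAt`), take the end data from `horizon_data` / `infinity_data`, apply the core at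
`(x, x′)`, and convert back with `‖u x‖ = √(r² + a²)‖R r‖` and `Kerr.wronskian_schrodingerForm`.
(B): the kernel bound at `θ = 1` with `r → r₊⁺` (`Kerr.Costa2019.tendsto_norm_horizonSolution`)
and then `r′ → ∞` (`Kerr.Costa2019.tendsto_norm_infinitySolution`), `𝔚` being constant
(`Kerr.Costa2019.radialWronskian_eq`), gives `1 ≤ CΛ^N κ^{-N}‖𝔚(r₀)‖`; square. -/
theorem stub_polyPlumbing :
    (∀ P : ℝ → ℝ → ℝ → ℤ → Prop, (∀ M a ω m, P M a ω m → P M a (-ω) (-m)) →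
    (∀ M : ℝ, 0 < M → ∀ θ : ℝ, 0 < θ → ∃ (a₁ ε₀ C : ℝ) (N : ℕ), a₁ < M ∧ 0 < ε₀ ∧ 0 < C ∧
      ∀ a : ℝ, a₁ ≤ |a| → Kerr.IsSubextremal M a →
        ∀ (ω : ℝ) (m : ℤ) (Λ : ℝ), Kerr.IsAdmissibleTriple a ω m Λ → 0 < m →
          |ω - m * Kerr.horizonAngularVelocity M a| ≤ ε₀ * |(m : ℝ)| → P M a ω m →
            ∀ ρ : ℝ → ℝ, Kerr.IsTortoiseRadius M a ρ →
            ∀ uH uH₁ uI uI₁ : ℝ → ℂ,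
              (∀ x, HasDerivAt uH (uH₁ x) x ∧
                HasDerivAt uH₁ (-(((ω ^ 2 - Kerr.sepPotential M a ω m Λ (ρ x) : ℝ) : ℂ) * uH x)) x) →
              (∀ x, HasDerivAt uI (uI₁ x) x ∧
                HasDerivAt uI₁ (-(((ω ^ 2 - Kerr.sepPotential M a ω m Λ (ρ x) : ℝ) : ℂ) * uI x)) x) →
              Tendsto (fun x ↦ ‖uH x‖) atBot (𝓝 1) →
              Tendsto (fun x ↦ ‖uH₁ x‖) atBot (𝓝 |ω - m * Kerr.horizonAngularVelocity M a|) →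
              (∀ x, (starRingEnd ℂ (uH x) * uH₁ x).im = -(ω - m * Kerr.horizonAngularVelocity M a)) →
              Tendsto (fun x ↦ ‖uI x‖) atTop (𝓝 1) →
              Tendsto (fun x ↦ ‖uI₁ x‖) atTop (𝓝 |ω|) →
              (∀ x, (starRingEnd ℂ (uI x) * uI₁ x).im = ω) →
                ∀ x x' : ℝ, x ≤ x' → Kerr.rPlus M a + θ * (Kerr.rPlus M a - Kerr.rMinus M a) ≤ ρ x' →
                  ‖uH x‖ * ‖uI x'‖ ≤
                    C * Λ ^ N * (Kerr.surfaceGravity M a)⁻¹ ^ N * ‖uH x * uI₁ x - uI x * uH₁ x‖) →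
    (∀ M : ℝ, 0 < M → ∀ θ : ℝ, 0 < θ → ∃ (a₁ ε₀ C : ℝ) (N : ℕ), a₁ < M ∧ 0 < ε₀ ∧ 0 < C ∧
      ∀ a : ℝ, a₁ ≤ |a| → Kerr.IsSubextremal M a →
        ∀ (ω : ℝ) (m : ℤ) (Λ : ℝ), Kerr.IsAdmissibleTriple a ω m Λ → m ≠ 0 →
          |ω - m * Kerr.horizonAngularVelocity M a| ≤ ε₀ * |(m : ℝ)| → P M a ω m →
            ∀ RH RI : ℝ → ℂ,
              Kerr.IsRadialTeukolskySolution M a 0 ω m (Λ - a ^ 2 * ω ^ 2) RH →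
              Kerr.IsNormalisedHorizonSolution M a 0 ω m RH →
              Kerr.IsRadialTeukolskySolution M a 0 ω m (Λ - a ^ 2 * ω ^ 2) RI →
              Kerr.IsNormalisedInfinitySolution M 0 ω RI →
                ∀ r r' : ℝ, Kerr.rPlus M a < r → r ≤ r' →
                  Kerr.rPlus M a + θ * (Kerr.rPlus M a - Kerr.rMinus M a) ≤ r' →
                    Real.sqrt (r ^ 2 + a ^ 2) * ‖RH r‖ * (Real.sqrt (r' ^ 2 + a ^ 2) * ‖RI r'‖) ≤
                      C * Λ ^ N * (Kerr.surfaceGravity M a)⁻¹ ^ N * ‖Kerr.radialWronskian M a 0 RH RI r‖)) ∧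
    ((∀ M : ℝ, 0 < M → ∀ θ : ℝ, 0 < θ → ∃ (a₁ ε₀ C : ℝ) (N : ℕ), a₁ < M ∧ 0 < ε₀ ∧ 0 < C ∧
      ∀ a : ℝ, a₁ ≤ |a| → Kerr.IsSubextremal M a →
        ∀ (ω : ℝ) (m : ℤ) (Λ : ℝ), Kerr.IsAdmissibleTriple a ω m Λ → m ≠ 0 →
          |ω - m * Kerr.horizonAngularVelocity M a| ≤ ε₀ * |(m : ℝ)| →
            ∀ RH RI : ℝ → ℂ,
              Kerr.IsRadialTeukolskySolution M a 0 ω m (Λ - a ^ 2 * ω ^ 2) RH →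
              Kerr.IsNormalisedHorizonSolution M a 0 ω m RH →
              Kerr.IsRadialTeukolskySolution M a 0 ω m (Λ - a ^ 2 * ω ^ 2) RI →
              Kerr.IsNormalisedInfinitySolution M 0 ω RI →
                ∀ r r' : ℝ, Kerr.rPlus M a < r → r ≤ r' →
                  Kerr.rPlus M a + θ * (Kerr.rPlus M a - Kerr.rMinus M a) ≤ r' →
                    Real.sqrt (r ^ 2 + a ^ 2) * ‖RH r‖ * (Real.sqrt (r' ^ 2 + a ^ 2) * ‖RI r'‖) ≤
                      C * Λ ^ N * (Kerr.surfaceGravity M a)⁻¹ ^ N * ‖Kerr.radialWronskian M a 0 RH RI r‖) →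
    (∀ M : ℝ, 0 < M → ∃ (a₁ ε₀ C : ℝ) (N : ℕ), a₁ < M ∧ 0 < ε₀ ∧ 0 < C ∧
      ∀ a : ℝ, a₁ ≤ |a| → Kerr.IsSubextremal M a →
        ∀ (ω : ℝ) (m : ℤ) (Λ : ℝ), Kerr.IsAdmissibleTriple a ω m Λ → m ≠ 0 →
          |ω - m * Kerr.horizonAngularVelocity M a| ≤ ε₀ * |(m : ℝ)| →
            ∀ RH RI : ℝ → ℂ,
              Kerr.IsRadialTeukolskySolution M a 0 ω m (Λ - a ^ 2 * ω ^ 2) RH →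
              Kerr.IsNormalisedHorizonSolution M a 0 ω m RH →
              Kerr.IsRadialTeukolskySolution M a 0 ω m (Λ - a ^ 2 * ω ^ 2) RI →
              Kerr.IsNormalisedInfinitySolution M 0 ω RI →
                ∀ r : ℝ, Kerr.rPlus M a < r →
                  1 ≤ (C * Λ ^ N * (Kerr.surfaceGravity M a)⁻¹ ^ N) ^ 2 *
                    ‖Kerr.radialWronskian M a 0 RH RI r‖ ^ 2)) := by
  refine ⟨fun P hP hcore ↦ ?_, fun hK M hM ↦ ?_⟩
  · -- (A) WLOG `0 < m` (conjugation symmetry of the normalised pair, `P` invariant, `Λ` fixed)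
    refine Kerr.Costa2019.coneKernelBound_of_pos_poly P hP fun M hM θ hθ ↦ ?_
    obtain ⟨a₁, ε₀, C, N, ha₁, hε₀, hC, hK⟩ := hcore M hM θ hθ
    -- shrink the constants so that `ω ≠ 0` in the cone
    obtain ⟨a₂, ε₂, ha₂, hε₂, ha₁₂, hε₂₀, hω₂⟩ := cone_constants hM ha₁ hε₀
    refine ⟨a₂, ε₂, C, N, ha₂, hε₂, hC, ?_⟩
    intro a ha hsub ω m Λ hadm hm hcone hPw RH RI hH hnH hI hnI r r' hr hrr' hr'
    have ha' : |a| < M := hsub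
    have hω : ω ≠ 0 := hω₂ a ω m ha hm.ne' hcone
    have ha₁a : a₁ ≤ |a| := ha₁₂.trans ha
    have hcone' : |ω - m * Kerr.horizonAngularVelocity M a| ≤ ε₀ * |(m : ℝ)| :=
      hcone.trans (mul_le_mul_of_nonneg_right hε₂₀ (abs_nonneg _))
    -- Carter's variable: a tortoise radius `ρ`, `r = ρ x`, `r' = ρ x'`, `x ≤ x'`
    obtain ⟨ρ, hρ⟩ := Kerr.exists_isTortoiseRadius hsub
    obtain ⟨x, rfl⟩ := hρ.exists_apply_eq hr
    obtain ⟨x', rfl⟩ := hρ.exists_apply_eq (hr.trans_le hrr')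
    have hxx' : x ≤ x' := (hρ.strictMono hsub).le_iff_le.1 hrr'
    -- `u = √(ρ² + a²)·R ∘ ρ`, its tortoise derivative, and the end data
    obtain ⟨uH₁, hduH, huH₁⟩ := carter_hasDerivAt hM ha' hH hρ
    obtain ⟨uI₁, hduI, huI₁⟩ := carter_hasDerivAt hM ha' hI hρ
    obtain ⟨hlimH, hlimH₁, hfluxH⟩ := horizon_data hM hsub hH hnH hρ huH₁
    obtain ⟨hlimI, hlimI₁, hfluxI⟩ := infinity_data hM hsub hω hI hnI hρ huI₁
    -- the core bound at `(x, x')`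
    have key : ‖((Real.sqrt (ρ x ^ 2 + a ^ 2) : ℝ) : ℂ) * RH (ρ x)‖ *
        ‖((Real.sqrt (ρ x' ^ 2 + a ^ 2) : ℝ) : ℂ) * RI (ρ x')‖ ≤
        C * Λ ^ N * (Kerr.surfaceGravity M a)⁻¹ ^ N *
          ‖((Real.sqrt (ρ x ^ 2 + a ^ 2) : ℝ) : ℂ) * RH (ρ x) * uI₁ x -
            ((Real.sqrt (ρ x ^ 2 + a ^ 2) : ℝ) : ℂ) * RI (ρ x) * uH₁ x‖ :=
      hK a ha₁a hsub ω m Λ hadm hm hcone' hPw ρ hρ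
        (fun y ↦ ((Real.sqrt (ρ y ^ 2 + a ^ 2) : ℝ) : ℂ) * RH (ρ y)) uH₁
        (fun y ↦ ((Real.sqrt (ρ y ^ 2 + a ^ 2) : ℝ) : ℂ) * RI (ρ y)) uI₁
        hduH hduI hlimH hlimH₁ hfluxH hlimI hlimI₁ hfluxI x x' hxx' hr'
    -- back to `R`: `‖u‖ = √(r² + a²)‖R‖` and `u_𝓗 u_𝓘′ − u_𝓘 u_𝓗′ = 𝔚`
    have hdH : DifferentiableAt ℝ RH (ρ x) := by
      obtain ⟨R', R'', hd⟩ := hH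
      exact (hd _ (hρ.rPlus_lt x)).1.differentiableAt
    have hdI : DifferentiableAt ℝ RI (ρ x) := by
      obtain ⟨R', R'', hd⟩ := hI
      exact (hd _ (hρ.rPlus_lt x)).1.differentiableAt
    rw [norm_weight_mul, norm_weight_mul, huH₁ x, huI₁ x,
      Kerr.wronskian_schrodingerForm ha' hρ hdH hdI] at key
    exact key
  · -- (B) the kernel bound with collar parameter `θ = 1`; keep its constants
    obtain ⟨a₁, ε₀, C, N, ha₁, hε₀, hC, hKer⟩ := hK M hM 1 one_pos
    refine ⟨a₁, ε₀, C, N, ha₁, hε₀, hC, ?_⟩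
    intro a ha hsub ω m Λ hadm hm hcone RH RI hH hnH hI hnI r₀ hr₀
    have ha' : |a| < M := hsub
    have hd : 0 < Kerr.rPlus M a - Kerr.rMinus M a := sub_pos.2 hsub.rMinus_lt_rPlus
    have hX : Kerr.rPlus M a < Kerr.rPlus M a + 1 * (Kerr.rPlus M a - Kerr.rMinus M a) := by
      linarith
    -- `1 ≤ CΛ^N κ^{-N} ‖𝔚(r₀)‖` by the two end-point limits and the constancy of `𝔚`
    have hkey : 1 ≤ C * Λ ^ N * (Kerr.surfaceGravity M a)⁻¹ ^ N *
        ‖Kerr.radialWronskian M a 0 RH RI r₀‖ := by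
      refine one_le_of_kernelBound hX (Kerr.Costa2019.tendsto_norm_horizonSolution hnH)
        (Kerr.Costa2019.tendsto_norm_infinitySolution (a := a) hnI) (fun r r' hr hrr' hr' ↦ ?_)
      have hb := hKer a ha hsub ω m Λ hadm hm hcone RH RI hH hnH hI hnI r r' hr hrr' hr'
      rwa [Kerr.Costa2019.radialWronskian_eq ha'.le hH hI hr hr₀] at hb
    calc (1 : ℝ) ≤ (C * Λ ^ N * (Kerr.surfaceGravity M a)⁻¹ ^ N *
          ‖Kerr.radialWronskian M a 0 RH RI r₀‖) ^ 2 := one_le_pow₀ hkey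
      _ = (C * Λ ^ N * (Kerr.surfaceGravity M a)⁻¹ ^ N) ^ 2 *
          ‖Kerr.radialWronskian M a 0 RH RI r₀‖ ^ 2 := mul_pow _ _ 2

end Summit.FinalStateConjecture.FinalStateConjecture.Theorems.KappaExplicitWaveDecay.OlverDunsterUniformReduction

end
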